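import Literature.AlgebraicGeometry.HodgeTheory.FermatInductiveClaims
import Literature.AlgebraicGeometry.HodgeTheory.PermutationSymmetry
import HarnessLib

/-!
# Aoki's claim(α) is invariant under permutations of the coordinates; reduction of Thm. 1-4 (i) to literal juxtaposition

Family `hodge`, layer `Literature/AlgebraicGeometry/HodgeTheory`. Proof file next to the named facts
of `FermatInductiveClaims` (Aoki, J. Math. Soc. Japan 39 (1987) Thm. 1-4; Shioda, Math. Ann. 245
(1979) Thm. I; da Silva, arXiv:2101.04739, Thm. 2.2 / Cor. 2.3), companion of the proof files
`FermatInductiveClaimsProofs` (Aoki's `p`-standard cycles, Thm. 2-1) and `ShiodaClaimPairedProofs`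
(Shioda's linear subspaces, Thm. 1-1). Everything here is PROVED; no named fact is introduced. It supplies the first, symmetry, layer of the printed proof of
`Aoki1987_claim_juxtaposition` — the passage between "`α ∼ β′∗γ′`, where `∼` means equality up to
permutation between factors" (da Silva (P1); Aoki §1) and the literal juxtaposition
`β′∗γ′ = (b₀, …, b_r, c₀, …, c_s)` to which Shioda's inductive structure applies.

Part 1 (any form `F`, sequel of `PermutationSymmetry`, parallel to `DiagonalSymmetryStability`):

* `permAut_left_mul`, `permAut_left_one`, `permAutIso` — the coordinate permutations `p_π` form a
  GROUP of automorphisms of the scheme `X_F` (Mathlib `Proj.map_comp`, `Proj.map_id`; the closed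
  immersion `X_F ↪ ℙⁿ⁺¹` is a monomorphism), so each `p_π` is an isomorphism, hence flat;
* `map_permMap_mem_algebraicClasses` — **`p_π^*` preserves `algebraicClasses X_F p = Nᵖ H²ᵖ`**
  (`map_mem_algebraicClasses_of_flat`); `map_permMap_inv_map_permMap` (`p_{π⁻¹}^* p_π^* = id`);
* `diagonalMap_comp_permMap` — **`g_{b ∘ π} ∘ p_π = p_π ∘ g_b`**: the permutations normalise the
  diagonal symmetries (`[z ∘ π] ↦ [(b ∘ π) • (z ∘ π)] = [(b • z) ∘ π]`).

Part 2 (the Fermat variety `Xⁿₘ`, every `π` being a symmetry of `Σ xᵢᵐ`):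

* `map_permMap_mem_fermatEigenspace` — **`p_π^* V(α) ⊆ V(α ∘ π⁻¹)`** (`χ_α(b ∘ π) = χ_{α∘π⁻¹}(b)`);
* `FermatCharacter.Claim.comp_perm`, `FermatCharacter.claim_comp_perm_iff`,
  `FermatCharacter.Claim.of_univ_val_map_eq` — **claim(α) depends only on the multiset of values
  of `α`** (codimension `0` is trivial, `algebraicClasses _ 0 = ⊤`);
* `FermatCharacter.append α β` — the literal juxtaposition `α∗β` of `α ∈ (ℤ/m)^{2r+2}`,
  `β ∈ (ℤ/m)^{2s+2}` as a character of `X^{2(r+s+1)}ₘ`, with `univ_val_map_append`, `IsHodge.append`;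
* `Aoki1987_claim_juxtaposition_of_append` — **the tree's rendering of Thm. 1-4 (i) (juxtaposition
  up to permutation, `univ.val.map γ = univ.val.map α + univ.val.map β`) follows from its literal,
  printed form** `claim(α) ∧ claim(β) ⟹ claim(α∗β)` (da Silva Cor. 2.3 (a)): the only strengthening
  of the letter of the source made in `FermatInductiveClaims` is harmless;
* `FermatCharacter.Claim.append_of_typeII` — the literal form from Shioda's type-II morphism
  `Φ = φ_* ∘ pr^*` (the ruled join) taken as EXPLICIT HYPOTHESES on the tree's carriers (a bilinear
  `Φ` carrying pairs of algebraic classes to algebraic classes, with `V(α∗β) ⊆ span Φ(V(α) × V(β))`):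
  the exact shape of the input that remains to be constructed (fact-decomposition discipline, as in
  `FermatHodgeConjectureAssembly`: proof obligations of the parent as hypotheses, no new named fact).

## What is NOT here

The literal form itself, i.e. Shioda's inductive structure (Math. Ann. 245 Thm. I; da Silva Thm. 2.2:
the type-II morphism `f(Z₁ ⊗ Z₂) = m · Z₁ ∧ Z₂`, the ruled join, a `Gⁿₘ`-equivariant ISOMORPHISM
onto `Hⁿ_prim`), which needs the blow-up / `μₘ`-quotient diagram of Shioda–Katsura and a Gysin
push-forward compatible with algebraic classes — neither is in the tree yet.

## References

* [Aoki1987] N. Aoki, Some new algebraic cycles on Fermat varieties, J. Math. Soc. Japan 39 (1987)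
  385–396, §1 and Thm. 1-4 (i).
* [Shioda1979HodgeFermat] T. Shioda, The Hodge conjecture for Fermat varieties, Math. Ann. 245
  (1979) 175–184, §1, Thm. I (cite-only).
* [Shioda1979PJA] T. Shioda, Proc. Japan Acad. 55A (1979) 111–114, §4 (the symmetries and `V(α)`).
* [daSilva2021HodgeFermat] G. da Silva Jr., Notes on the Hodge Conjecture for Fermat Varieties,
  arXiv:2101.04739, Thm. 2.2, Cor. 2.3 (a), condition (P1) ("`∼` means equality up to permutation
  between factors") (text read).
* [Hartshorne1977] R. Hartshorne, Algebraic Geometry (1977), II Example 7.1.1.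
-/

noncomputable section

open CategoryTheory AlgebraicGeometry MvPolynomial Finset

namespace Literature.AlgebraicGeometry.HodgeTheory

open Literature.AlgebraicGeometry.Motives Literature.AlgebraicTopology.SingularHomology

/-! ## Part 1 (general `F`): the `p_π` as scheme automorphisms; `p_π^*` on algebraic classes and on the diagonal symmetries -/

section General

attribute [local instance] MvPolynomial.gradedAlgebra Motives.ProjBaseChange.algebraBase

variable {n : ℕ}

/-- The grading of `ℂ[x₀, …, x_{n+1}]` by degree (local notation; `ℙⁿ⁺¹_ℂ = Proj 𝓐`). [folklore] -/
local notation "𝓐" => MvPolynomial.homogeneousSubmodule (Fin (n + 2)) ℂ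

/-! ### The permutation symmetries form a group of automorphisms of `X_F` -/

section Group

variable (F : MvPolynomial (Fin (n + 2)) ℂ) {π ρ : Equiv.Perm (Fin (n + 2))}

/-- The graded substitution `σ_π : xᵢ ↦ x_{π i}`, abbreviated. [folklore] -/
abbrev permSubstGraded (π : Equiv.Perm (Fin (n + 2))) : 𝓐 →+*ᵍ 𝓐 :=
  ProjectiveSpace.substGraded (permSubst π) (isHomogeneous_permSubst π)

/-- `σ_π` moves the irrelevant ideal onto itself (the hypothesis of Mathlib's `Proj.map`). [folklore] -/
theorem irrelevant_le_map_permSubstGraded (π : Equiv.Perm (Fin (n + 2))) :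
    HomogeneousIdeal.irrelevant 𝓐 ≤ (HomogeneousIdeal.irrelevant 𝓐).map (permSubstGraded π) :=
  ProjectiveSpace.irrelevant_le_map_substGraded _ _ _ (isHomogeneous_permSubst π⁻¹)
    (aeval_permSubst_aeval_permSubst_inv π)

/-- `σ_{πρ} = σ_π ∘ σ_ρ` as graded ring endomorphisms of `ℂ[x₀, …, x_{n+1}]`. [folklore] -/
theorem permSubstGraded_mul (π ρ : Equiv.Perm (Fin (n + 2))) :
    permSubstGraded (n := n) (π * ρ) = (permSubstGraded π).comp (permSubstGraded ρ) := by
  ext p : 1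
  change aeval (permSubst (π * ρ)) p = aeval (permSubst π) (aeval (permSubst ρ) p)
  rw [aeval_permSubst_aeval_permSubst]

/-- `σ_1 = id` as a graded ring endomorphism. [folklore] -/
theorem permSubstGraded_one : permSubstGraded (n := n) 1 = GradedRingHom.id 𝓐 := by
  ext p : 1
  change aeval (permSubst (1 : Equiv.Perm (Fin (n + 2)))) p = p
  rw [aeval_permSubst_one]

/-- **`[z] ↦ [z ∘ (πρ)]` is `[z] ↦ [z ∘ π]` followed by `[z] ↦ [z ∘ ρ]`** on `ℙⁿ⁺¹_ℂ` (underlying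
schemes; Mathlib `Proj.map_comp`). [cite: Hartshorne1977, II Example 7.1.1] -/
theorem permProjMap_left_mul (π ρ : Equiv.Perm (Fin (n + 2))) :
    (permProjMap (n := n) (π * ρ)).left = (permProjMap π).left ≫ (permProjMap ρ).left := by
  show (Proj.map (permSubstGraded (π * ρ)) (irrelevant_le_map_permSubstGraded (π * ρ)) : Proj 𝓐 ⟶ Proj 𝓐) =
    Proj.map (permSubstGraded π) (irrelevant_le_map_permSubstGraded π) ≫
      Proj.map (permSubstGraded ρ) (irrelevant_le_map_permSubstGraded ρ)
  rw [← Proj.map_comp]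
  congr 1
  exact permSubstGraded_mul π ρ

/-- `[z] ↦ [z ∘ 1]` is the identity of `ℙⁿ⁺¹_ℂ` (Mathlib `Proj.map_id`). [cite: Hartshorne1977, II Example 7.1.1] -/
theorem permProjMap_left_one :
    (permProjMap (n := n) (1 : Equiv.Perm (Fin (n + 2)))).left = 𝟙 _ := by
  show (Proj.map (permSubstGraded 1) (irrelevant_le_map_permSubstGraded 1) : Proj 𝓐 ⟶ Proj 𝓐) = 𝟙 (Proj 𝓐)
  convert Proj.map_id (𝒜 := 𝓐) using 2
  exact permSubstGraded_one

/-- **`p_{πρ} = p_π ≫ p_ρ`** on the hypersurface `X_F` (underlying schemes): both sides agree after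
the closed immersion `X_F ↪ ℙⁿ⁺¹`, a monomorphism. [cite: Shioda1979HodgeFermat, §1] -/
theorem permAut_left_mul (hπ : π ∈ permStabilizer F) (hρ : ρ ∈ permStabilizer F) :
    (permAut F (mul_mem hπ hρ)).left = (permAut F hπ).left ≫ (permAut F hρ).left := by
  rw [← cancel_mono (SmoothHypersurface.hypersurfaceι F).left, permAut_left_comp_ι,
    permProjMap_left_mul, Category.assoc, permAut_left_comp_ι, permAut_left_comp_ι_assoc]

/-- **`p_1 = 𝟙`** on `X_F` (underlying schemes). [cite: Shioda1979HodgeFermat, §1] -/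
theorem permAut_left_one :
    (permAut F (one_mem (permStabilizer F))).left = 𝟙 _ := by
  rw [← cancel_mono (SmoothHypersurface.hypersurfaceι F).left, permAut_left_comp_ι,
    permProjMap_left_one, Category.id_comp, Category.comp_id]

/-- `p_π` and `p_{π⁻¹}` are mutually inverse (underlying schemes). [cite: Shioda1979HodgeFermat, §1] -/
theorem permAut_left_comp_inv (hπ : π ∈ permStabilizer F) :
    (permAut F hπ).left ≫ (permAut F (inv_mem hπ)).left = 𝟙 _ := by
  rw [← permAut_left_mul]
  have h : permAut F (mul_mem hπ (inv_mem hπ)) = permAut F (one_mem (permStabilizer F)) := by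
    congr 1; exact mul_inv_cancel π
  rw [h, permAut_left_one]

/-- `p_{π⁻¹}` and `p_π` are mutually inverse (underlying schemes). [cite: Shioda1979HodgeFermat, §1] -/
theorem permAut_left_inv_comp (hπ : π ∈ permStabilizer F) :
    (permAut F (inv_mem hπ)).left ≫ (permAut F hπ).left = 𝟙 _ := by
  rw [← permAut_left_mul]
  have h : permAut F (mul_mem (inv_mem hπ) hπ) = permAut F (one_mem (permStabilizer F)) := by
    congr 1; exact inv_mul_cancel π
  rw [h, permAut_left_one]

/-- **`p_π` is an automorphism of the scheme `X_F`**, with inverse `p_{π⁻¹}`. [cite: Shioda1979HodgeFermat, §1] -/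
def permAutIso (hπ : π ∈ permStabilizer F) :
    (SmoothHypersurface.hypersurface F).left ≅ (SmoothHypersurface.hypersurface F).left where
  hom := (permAut F hπ).left
  inv := (permAut F (inv_mem hπ)).left
  hom_inv_id := permAut_left_comp_inv F hπ
  inv_hom_id := permAut_left_inv_comp F hπ

/-- `p_π` is an isomorphism of schemes. [cite: Shioda1979HodgeFermat, §1] -/
instance isIso_permAut_left (hπ : π ∈ permStabilizer F) : IsIso (permAut F hπ).left :=
  (permAutIso F hπ).isIso_hom

end Group

/-! ### `p_π^*` preserves algebraic classes -/

section Algebraic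

variable (F : MvPolynomial (Fin (n + 2)) ℂ) {π : Equiv.Perm (Fin (n + 2))}

/-- **`p_π^*` preserves algebraic classes** (`X_F` smooth projective): `p_π` is an isomorphism, hence
flat, and flat pull-back respects the support filtration (`map_mem_algebraicClasses_of_flat`).
[cite: Shioda1979PJA, §4] [cite: GrothendieckTopology1969, §1] -/
theorem map_permMap_mem_algebraicClasses {d : ℕ} (hX : IsSmoothProjective d (SmoothHypersurface.hypersurface F))
    (hπ : π ∈ permStabilizer F) {p : ℕ} {c : complexBetti (SmoothHypersurface.hypersurface F) (2 * p)}
    (hc : c ∈ algebraicClasses (SmoothHypersurface.hypersurface F) p) :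
    singularCohomology.map ℂ ℂ (permMap F hπ) (2 * p) c ∈ algebraicClasses (SmoothHypersurface.hypersurface F) p := by
  haveI : IsLocallyNoetherian (SmoothHypersurface.hypersurface F).left :=
    Motives.IsSmoothProjective.isLocallyNoetherian_holds hX
  exact map_mem_algebraicClasses_of_flat (permAut F hπ) hc

end Algebraic

/-! ### `p_{π⁻¹}^* p_π^* = id`; the `p_π` normalise the diagonal symmetries -/

section Conj

variable {F : MvPolynomial (Fin (n + 2)) ℂ} {π : Equiv.Perm (Fin (n + 2))}

/-- `p_{π⁻¹}^* (p_π^* c) = c` on `Hᵏ(X_F(ℂ); ℂ)`. [folklore] -/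
theorem map_permMap_inv_map_permMap (hπ : π ∈ permStabilizer F) (k : ℕ)
    (c : complexBetti (SmoothHypersurface.hypersurface F) k) :
    singularCohomology.map ℂ ℂ (permMap F (inv_mem hπ)) k (singularCohomology.map ℂ ℂ (permMap F hπ) k c) = c := by
  change (singularCohomology.map ℂ ℂ (permMap F hπ) k ≫ singularCohomology.map ℂ ℂ (permMap F (inv_mem hπ)) k) c = c
  rw [← singularCohomology.map_comp, permMap_comp_inv, singularCohomology.map_id]
  rfl

/-- **`g_{b ∘ π} ∘ p_π = p_π ∘ g_b`**: on homogeneous coordinates both send `[z]` to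
`[(b • z) ∘ π] = [(b ∘ π) • (z ∘ π)]`. This is the relation by which `p_π^*` carries the
`χ`-eigenspace of a group of diagonal symmetries to the eigenspace of `χ ∘ (b ↦ b ∘ π)`.
[cite: Shioda1979HodgeFermat, §1] -/
theorem diagonalMap_comp_permMap (hπ : π ∈ permStabilizer F) {b : Fin (n + 2) → ℂˣ}
    (hb : b ∈ diagonalStabilizer F) (hbπ : (fun i ↦ b (π i)) ∈ diagonalStabilizer F) :
    (diagonalMap F hbπ).comp (permMap F hπ) = (permMap F hπ).comp (diagonalMap F hb) := by
  refine ContinuousMap.coe_injective (funext fun x ↦ ?_)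
  apply (isEmbedding_hypersurfacePoint (SmoothHypersurface.hypersurfaceι F)).injective
  rw [ContinuousMap.comp_apply, ContinuousMap.comp_apply, hypersurfacePoint_diagonalMap,
    hypersurfacePoint_permMap F hπ (diagonalMap F hb x), Projectivization.mk_eq_mk_iff']
  obtain ⟨t, ht⟩ := exists_rep_hypersurfacePoint_permMap F hπ x
  obtain ⟨s, hs⟩ := exists_rep_hypersurfacePoint_diagonalMap F hb x
  -- both representatives are multiples of `w = (b ∘ π) • (rep (pt x) ∘ π)`
  have hs0 : s ≠ 0 := by
    intro hs0
    refine Projectivization.rep_nonzero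
      (hypersurfacePoint (SmoothHypersurface.hypersurfaceι F) (diagonalMap F hb x)) ?_
    rw [hs, hs0, zero_smul]
  refine ⟨t * s⁻¹, ?_⟩
  rw [ht, hs]
  funext i
  simp only [Pi.smul_apply, Function.comp_apply, smul_eq_mul, smul_apply_eq_mul]
  field_simp

end Conj

end General

/-! ## Part 2: the Fermat variety -/

section Fermat

variable {n m : ℕ}

/-! ### `μₘⁿ⁺²` and its characters under permutations of the coordinates -/

/-- `μₘⁿ⁺²` is stable under permutations of the coordinates. [folklore] -/
theorem comp_perm_mem_fermatGroup {b : Fin (n + 2) → ℂˣ} (hb : b ∈ fermatGroup n m)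
    (π : Equiv.Perm (Fin (n + 2))) : (fun i ↦ b (π i)) ∈ fermatGroup n m :=
  mem_fermatGroup_iff.mpr fun i ↦ mem_fermatGroup_iff.mp hb (π i)

/-- **`χ_α(b ∘ π) = χ_{α ∘ π⁻¹}(b)`**: `∏ᵢ b_{π i}^{⟨αᵢ⟩} = ∏ⱼ b_j^{⟨α_{π⁻¹ j}⟩}`.
[cite: Shioda1979HodgeFermat, §1] -/
theorem fermatCharacter_comp_perm (α : Fin (n + 2) → ZMod m) (π : Equiv.Perm (Fin (n + 2)))
    {b : Fin (n + 2) → ℂˣ} (hb : b ∈ fermatGroup n m) (hbπ : (fun i ↦ b (π i)) ∈ fermatGroup n m) :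
    fermatCharacter m α ⟨fun i ↦ b (π i), hbπ⟩ = fermatCharacter m (α ∘ π.symm) ⟨b, hb⟩ := by
  rw [fermatCharacter_apply, fermatCharacter_apply]
  exact Fintype.prod_equiv π _ _ fun i ↦ by simp

/-- **`p_π^* V(α) ⊆ V(α ∘ π⁻¹)`.** For `c ∈ V(α) ⊆ Hᵏ(Xⁿₘ(ℂ); ℂ)` and the coordinate permutation
`p_π : [z] ↦ [z ∘ π]` of `Xⁿₘ`: `g_b^*(p_π^* c) = (p_π ∘ g_b)^* c = (g_{b∘π} ∘ p_π)^* c =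
p_π^*(χ_α(b ∘ π) c) = χ_{α∘π⁻¹}(b) p_π^* c` (`diagonalMap_comp_permMap`, `fermatCharacter_comp_perm`).
[cite: Shioda1979HodgeFermat, §1] [cite: Aoki1987, §1] -/
theorem map_permMap_mem_fermatEigenspace {α : Fin (n + 2) → ZMod m} {k : ℕ} (π : Equiv.Perm (Fin (n + 2)))
    {c : complexBetti (fermatHypersurface n m) k} (hc : c ∈ fermatEigenspace m α k) :
    singularCohomology.map ℂ ℂ (permMap (fermatPolynomial ℂ n m) (mem_permStabilizer_fermatPolynomial m π)) k c ∈
      fermatEigenspace m (α ∘ π.symm) k := by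
  rw [mem_fermatEigenspace_iff] at hc ⊢
  intro a
  have haπ : (fun i ↦ (a : Fin (n + 2) → ℂˣ) (π i)) ∈ fermatGroup n m := comp_perm_mem_fermatGroup a.2 π
  have hcomm := diagonalMap_comp_permMap (mem_permStabilizer_fermatPolynomial m π)
    (fermatGroup_le_diagonalStabilizer m a.2) (fermatGroup_le_diagonalStabilizer m haπ)
  have key : singularCohomology.map ℂ ℂ (diagonalMap _ (fermatGroup_le_diagonalStabilizer m a.2)) k
      (singularCohomology.map ℂ ℂ (permMap _ (mem_permStabilizer_fermatPolynomial m π)) k c) =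
      singularCohomology.map ℂ ℂ (permMap _ (mem_permStabilizer_fermatPolynomial m π)) k
        (singularCohomology.map ℂ ℂ (diagonalMap _ (fermatGroup_le_diagonalStabilizer m haπ)) k c) := by
    change (singularCohomology.map ℂ ℂ (permMap _ (mem_permStabilizer_fermatPolynomial m π)) k ≫
        singularCohomology.map ℂ ℂ (diagonalMap _ (fermatGroup_le_diagonalStabilizer m a.2)) k) c =
      (singularCohomology.map ℂ ℂ (diagonalMap _ (fermatGroup_le_diagonalStabilizer m haπ)) k ≫
        singularCohomology.map ℂ ℂ (permMap _ (mem_permStabilizer_fermatPolynomial m π)) k) c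
    rw [← singularCohomology.map_comp, ← singularCohomology.map_comp, hcomm]
  rw [key, hc ⟨_, haπ⟩, map_smul, fermatCharacter_comp_perm α π a.2 haπ]

namespace FermatCharacter

variable {r s : ℕ}

/-! ### claim(α) is invariant under permutations of the coordinates -/

/-- **claim(α) ⟹ claim(α ∘ π)** for every permutation `π` of the `2r + 2` coordinates of `X²ʳₘ`:
a class `c ∈ V(α ∘ π)` has `p_π^* c ∈ V(α)`, algebraic by claim(α), and `c = p_{π⁻¹}^*(p_π^* c)` is
then algebraic (`p_{π⁻¹}` is an automorphism of the scheme `X²ʳₘ`, so its pull-back preserves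
`algebraicClasses`, `map_permMap_mem_algebraicClasses`). In codimension `r = 0` every class is
algebraic. This is the use of the symmetric group in "`α ∼ β`: equality up to permutation".
[cite: Aoki1987, §1] [cite: daSilva2021HodgeFermat, §2, condition (P1)] -/
theorem Claim.comp_perm [NeZero m] {α : Fin (2 * r + 2) → ZMod m} (h : Claim m r α)
    (π : Equiv.Perm (Fin (2 * r + 2))) : Claim m r (α ∘ π) := by
  rcases Nat.eq_zero_or_pos r with rfl | hr
  · intro c _
    rw [algebraicClasses_zero]
    exact Submodule.mem_top
  · intro c hc
    have hX : IsSmoothProjective (2 * r) (fermatHypersurface (2 * r) m) :=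
      isSmoothProjective_fermatHypersurface (by omega) NeZero.one_le
    have hπ := mem_permStabilizer_fermatPolynomial (n := 2 * r) m π
    have h1 := map_permMap_mem_fermatEigenspace π hc
    have h2 : (α ∘ π) ∘ π.symm = α := by
      funext j
      simp
    rw [h2] at h1
    have h3 := map_permMap_mem_algebraicClasses _ hX (inv_mem hπ) (h h1)
    rwa [map_permMap_inv_map_permMap] at h3

/-- claim(α ∘ π) ⟺ claim(α). [cite: Aoki1987, §1] -/
theorem claim_comp_perm_iff [NeZero m] (α : Fin (2 * r + 2) → ZMod m) (π : Equiv.Perm (Fin (2 * r + 2))) :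
    Claim m r (α ∘ π) ↔ Claim m r α := by
  refine ⟨fun h ↦ ?_, fun h ↦ h.comp_perm π⟩
  have h' := h.comp_perm π.symm
  have h2 : (α ∘ π) ∘ π.symm = α := by
    funext j
    simp
  rwa [h2] at h'

/-- Multiplicities of the multiset of values: `#{i | xᵢ = a}` is the count of `a`. [folklore] -/
theorem card_subtype_eq_count {K : ℕ} {X : Type*} [DecidableEq X] (x : Fin K → X) (a : X) :
    Fintype.card {i // x i = a} = Multiset.count a (univ.val.map x) := by
  rw [Fintype.card_subtype, Multiset.count_map, ← Finset.filter_val, Finset.card_val]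
  congr 1
  exact Finset.filter_congr fun i _ ↦ eq_comm

/-- **Tuples with the same multiset of values differ by a permutation of the indices** (glue the
bijections between the fibres, which have the same cardinalities). [folklore] -/
theorem exists_perm_eq_comp_of_univ_val_map_eq {K : ℕ} {X : Type*} [DecidableEq X] {x y : Fin K → X}
    (h : univ.val.map x = univ.val.map y) : ∃ σ : Equiv.Perm (Fin K), y = x ∘ σ := by
  have e : ∀ a : X, {i // y i = a} ≃ {i // x i = a} := fun a ↦
    Fintype.equivOfCardEq (by rw [card_subtype_eq_count, card_subtype_eq_count, h])
  exact ⟨Equiv.ofFiberEquiv e, funext fun i ↦ (Equiv.ofFiberEquiv_map e i).symm⟩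

/-- **claim(α) depends only on the multiset of values of `α`** (`γ ∼ α` ⟹ (claim(α) ⟹ claim(γ))).
[cite: Aoki1987, §1] [cite: daSilva2021HodgeFermat, §2, condition (P1)] -/
theorem Claim.of_univ_val_map_eq [NeZero m] {α γ : Fin (2 * r + 2) → ZMod m}
    (hγ : univ.val.map γ = univ.val.map α) (h : Claim m r α) : Claim m r γ := by
  classical
  obtain ⟨σ, rfl⟩ := exists_perm_eq_comp_of_univ_val_map_eq hγ.symm
  exact h.comp_perm σ

/-! ### Literal juxtaposition -/

/-- The number of coordinates of `X^{2(r+s+1)}ₘ` is that of `X²ʳₘ` plus that of `X²ˢₘ`. [folklore] -/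
theorem two_mul_add_two (r s : ℕ) : 2 * (r + s + 1) + 2 = (2 * r + 2) + (2 * s + 2) := by ring

/-- **The literal juxtaposition `α∗β = (a₀, …, a_{2r+1}, b₀, …, b_{2s+1})`** of a character `α` of
`X²ʳₘ` and a character `β` of `X²ˢₘ`, as a character of `X^{2(r+s+1)}ₘ` (`Fin.append` through the
cast `Fin (2(r+s+1)+2) ≃ Fin ((2r+2)+(2s+2))`). [cite: Aoki1987, §1] [cite: daSilva2021HodgeFermat, §2 (β′∗γ′)] -/
def append (α : Fin (2 * r + 2) → ZMod m) (β : Fin (2 * s + 2) → ZMod m) :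
    Fin (2 * (r + s + 1) + 2) → ZMod m :=
  Fin.append α β ∘ finCongr (two_mul_add_two r s)

/-- The multiset of values of `α∗β` is that of `α` plus that of `β`. [folklore] -/
theorem univ_val_map_append (α : Fin (2 * r + 2) → ZMod m) (β : Fin (2 * s + 2) → ZMod m) :
    univ.val.map (append α β) = univ.val.map α + univ.val.map β := by
  rw [append, ← Multiset.map_map, Multiset.map_univ_val_equiv, Fin.univ_val_map, Fin.univ_val_map,
    Fin.univ_val_map, List.ofFn_fin_append, Multiset.coe_add]

/-- The juxtaposition of Hodge characters is a Hodge character (`|t(α∗β)| = |tα| + |tβ|`).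
[cite: Shioda1979PJA, §1] -/
theorem IsHodge.append [NeZero m] {α : Fin (2 * r + 2) → ZMod m} {β : Fin (2 * s + 2) → ZMod m}
    (hα : IsHodge α) (hβ : IsHodge β) : IsHodge (FermatCharacter.append α β) := by
  refine ⟨⟨fun i ↦ ?_, ?_⟩, fun t ↦ ?_⟩
  · unfold FermatCharacter.append
    refine Fin.addCases (motive := fun j ↦ Fin.append α β j ≠ 0) (fun i ↦ ?_) (fun i ↦ ?_)
      (finCongr (two_mul_add_two r s) i)
    · rw [Fin.append_left]; exact hα.1.1 i
    · rw [Fin.append_right]; exact hβ.1.1 i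
  · have hsum : ∑ i, FermatCharacter.append α β i = (univ.val.map (FermatCharacter.append α β)).sum := Finset.sum_eq_multiset_sum _ _
    rw [hsum, univ_val_map_append, Multiset.sum_add, ← Finset.sum_eq_multiset_sum,
      ← Finset.sum_eq_multiset_sum, hα.1.2, hβ.1.2, add_zero]
  · have key : ∀ {q : ℕ} (δ : Fin q → ZMod m),
        normSum (fun i ↦ (t : ZMod m) * δ i) = ((univ.val.map δ).map fun a ↦ ((t : ZMod m) * a).val).sum := by
      intro q δ
      rw [normSum, Finset.sum_eq_multiset_sum, Multiset.map_map]
      rfl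
    have h := key (FermatCharacter.append α β)
    rw [univ_val_map_append, Multiset.map_add, Multiset.sum_add, ← key, ← key] at h
    rw [h, mul_add, hα.2 t, hβ.2 t]
    ring

/-! ### The remaining input — Shioda's type-II morphism — as explicit hypotheses -/

/-- **claim(α) ∧ claim(β) ⟹ claim(α∗β), granted Shioda's type-II morphism.** The printed proof
(Shioda, Math. Ann. 245 Thm. I; da Silva Thm. 2.2 (c) and Cor. 2.3 (a)) produces a bilinear map
`Φ : H²ʳ(X²ʳₘ) × H²ˢ(X²ˢₘ) → H²⁽ʳ⁺ˢ⁺¹⁾(X^{2(r+s+1)}ₘ)` — `Φ = φ_* ∘ pr^*` through the `ℙ¹`-bundle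
`E → X²ʳₘ × X²ˢₘ` over the two disjoint sub-Fermat varieties `{y = 0}`, `{x = 0}` of
`X^{2(r+s+1)}ₘ` and its image, the divisor swept by the lines joining them ("`f(Z₁ ⊗ Z₂) = m Z₁ ∧ Z₂`,
the algebraic cycle obtained by joining `Z₁` and `Z₂` by lines") — which (hΦA) takes pairs of
algebraic classes to algebraic classes and (hΦV) whose values on `V(α) × V(β)` span a space
containing `V(α∗β)` (`f` is a `Gⁿₘ`-equivariant isomorphism onto `Hⁿ_prim`, and the
`(α∗β)`-isotypic part of its source is `V(α) ⊗ V(β)`). Granted such a `Φ` (hypotheses; the tree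
has neither the join nor a Gysin push-forward compatible with `algebraicClasses` yet), claim(α∗β)
follows from claim(α) and claim(β): `V(α∗β) ⊆ span Φ(V(α) × V(β)) ⊆ span Φ(alg × alg) ⊆ alg`.
[cite: Shioda1979HodgeFermat, Thm. I] [cite: daSilva2021HodgeFermat, Thm. 2.2 (c) and Cor. 2.3 (a)]
[cite: Aoki1987, Thm. 1-4 (i), p. 388] -/
theorem Claim.append_of_typeII {α : Fin (2 * r + 2) → ZMod m} {β : Fin (2 * s + 2) → ZMod m}
    (Φ : complexBetti (fermatHypersurface (2 * r) m) (2 * r) →ₗ[ℂ]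
      complexBetti (fermatHypersurface (2 * s) m) (2 * s) →ₗ[ℂ]
        complexBetti (fermatHypersurface (2 * (r + s + 1)) m) (2 * (r + s + 1)))
    (hΦA : ∀ c ∈ algebraicClasses (fermatHypersurface (2 * r) m) r,
      ∀ d ∈ algebraicClasses (fermatHypersurface (2 * s) m) s,
        Φ c d ∈ algebraicClasses (fermatHypersurface (2 * (r + s + 1)) m) (r + s + 1))
    (hΦV : fermatEigenspace m (append α β) (2 * (r + s + 1)) ≤
      Submodule.span ℂ (Set.image2 (fun c d ↦ Φ c d)
        (fermatEigenspace m α (2 * r)) (fermatEigenspace m β (2 * s))))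
    (hα : Claim m r α) (hβ : Claim m s β) : Claim m (r + s + 1) (append α β) := by
  intro x hx
  refine (Submodule.span_le.mpr ?_) (hΦV hx)
  rintro _ ⟨c, hc, d, hd, rfl⟩
  exact hΦA c (hα hc) d (hβ hd)

end FermatCharacter

/-! ### Thm. 1-4 (i) up to permutation from its literal form -/

/-- **`Aoki1987_claim_juxtaposition` (juxtaposition up to permutation of the coordinates) follows
from the literal printed form of Aoki's Thm. 1-4 (i) / da Silva's Cor. 2.3 (a)**:
"if claim(α) and claim(β) are true, then claim(α∗β) is also true", `α∗β` the literal juxtaposition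
(`FermatCharacter.append`). For `γ` with `univ.val.map γ = univ.val.map α + univ.val.map β` one has
`γ ∼ α∗β`, and claim depends only on the multiset of values
(`FermatCharacter.Claim.of_univ_val_map_eq`: the symmetric group acts on `Xⁿₘ`). The hypothesis is
exactly what Shioda's inductive structure (Math. Ann. 245 Thm. I; da Silva Thm. 2.2) proves and is
NOT discharged here. [cite: Aoki1987, Thm. 1-4 (i), p. 388] [cite: daSilva2021HodgeFermat, Cor. 2.3 (a) and condition (P1)] -/
theorem Aoki1987_claim_juxtaposition_of_append
    (h : ∀ (m r s : ℕ) [NeZero m] (α : Fin (2 * r + 2) → ZMod m) (β : Fin (2 * s + 2) → ZMod m),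
      FermatCharacter.IsHodge α → FermatCharacter.IsHodge β →
      FermatCharacter.Claim m r α → FermatCharacter.Claim m s β →
        FermatCharacter.Claim m (r + s + 1) (FermatCharacter.append α β)) :
    Aoki1987_claim_juxtaposition := by
  intro m r s _ α β γ hα hβ hγ hcα hcβ
  refine FermatCharacter.Claim.of_univ_val_map_eq ?_ (h m r s α β hα hβ hcα hcβ)
  rw [hγ, FermatCharacter.univ_val_map_append]

end Fermat

end Literature.AlgebraicGeometry.HodgeTheory

end
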